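import Summits.BirchSwinnertonDyer.BirchSwinnertonDyer.Theorems.GenusKolyvaginAtTwoEquivariantKolyvaginExactAtTwoFrobeniusCriterion
import Summits.BirchSwinnertonDyer.BirchSwinnertonDyer.Theorems.GenusKolyvaginAtTwoEquivariantChebotarevAtTwoQ5Shape
import Literature.NumberTheory.EllipticCurves.HeegnerPointsKolyvaginPrimaryProp82Proofs
import HarnessLib

/-!
# Route `GenusKolyvaginAtTwo`, LINE 6, KEY crux Q3 `EquivariantKolyvaginExactAtTwo`
# (stmt-BirchSwinnertonDyer-24882): McCALLUM'S LEMMA 5.3 WITH PROP. 2.2 OVER `ℚ_ℓ` AT `p = 2`,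
# from Kolyvagin reciprocity over `ℚ` — the `ℚ`-level twin of the tree's
# `lemma_5_3_descent_of_reciprocity` (which needs `p` odd), with NO `2`-adic defect

Helper (seat `bsd-line-gk2-p3` g11, cell `bsd-f1-sign2`; `--supports` the item, closes nothing). This is
leaf (B) / the `duality` field of the split descent `KolyvaginDescent.SplitHypothesesM` (gk2-p2, S7) for
the `E`-factor `V⁺ = H¹(ℚ, E[2^M])` of the eigen/`ℚ` architecture of Q3 (memo `Q3-KERNEL-EIGEN-v2`; for
the twin factor apply the same theorem to `E^{(d_K)}`, whose Gross–Kolyvagin primes are the same,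
`…TwinGrossPrimes`).

SETTING (`K = ℚ`). `E = W/ℚ` elliptic with `Δ < 0`; `ℓ` an odd prime with `ℓ ∈ v`, `E` good at `v`;
`q = 2^M`, `M ≥ 1`; `Frob(ℓ) = Frob(∞)` on `ℚ(E[q])` (`FrobEqFrobInfty W K q ℓ`, Gross (3.2) at depth
`M`; `K` is any number field carried by the predicate). Then (§1) `E[q]` is free of rank one over
`ℤ/q[c₀]` for every complex conjugation `c₀` (Q1 on `Δ < 0`, re-proved from the tree's ingredients) and a
Frobenius `F` at the prime `𝔓 ∣ ℓ` of the chosen embedding acts on `E[q]` as such a `c₀`: `F` is a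
REGULAR involution there and inverts `μ_q`; (§2) for `d ∈ H¹(ℚ, E[q])` the tame values `[d, σ]`,
`σ ∈ I_𝔓`, satisfy **`F·[d, σ] = [d, FσF⁻¹] = [d, σ⁻¹] = −[d, σ]`** (Kummer theory of `ℓ^{1/q}`:
`θ(FσF⁻¹) = F(θ(σ)) = θ(σ)⁻¹`, tree `InertiaTame`), they form a cyclic group, and `2^a d` NOT Selmer
at `v` gives a tame value `t₁` with `2^a t₁ ≠ 0` (Gross (7.1)); (§3) **MAIN**
`lemma_5_3_descent_of_reciprocity_rat_two`: if moreover `s ∈ H¹(ℚ, E[q])` is Selmer at `v` and the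
reciprocity value vanishes — `e([s, F′], [d, σ]) = 0` for every Frobenius `F′` at `𝔓` acting on `E[q]` as a
complex conjugation and every `σ ∈ I_𝔓`, `e` an alternating left-non-degenerate pairing on `E[q]` (the
Weil pairing through Kolyvagin's (7.6); McCallum Prop. 2.2) — then **`2^{M−1−a}·s_v = 0`**, the printed
exponent of Lemma 5.3 (`…FrobeniusCriterion.pow_zsmul_mem_torsionLocalKer_of_pairing_eq_zero`: over
`ℚ_ℓ` the unramified value `[s, F]` is read modulo `(F − 1)E[q]` and pairs with the conorm line
WITHOUT the lost bit of the `K_λ`-level eigen argument).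

Everything is PROVED (no definition, no named fact, no `sorry`, standard axioms). What is NOT here:
the reciprocity value itself ((R)_ℚ: Poitou–Tate over `ℚ` + Kolyvagin's formula (7.6) over `ℚ_ℓ`),
exactly as for the tree's `K`-level leaf. BSD is not proved by any of this.

References: [McCallumLMS1991] §2 Prop. 2.2, §3 (3), §5 Lemma 5.3; [GrossLMS1991] §3 (3.2)–(3.3), (7.1),
Props. 8.1–8.2, 9.6; [SerreInventiones1972] §1.3, §1.8.
-/

set_option autoImplicit false
set_option linter.dupNamespace false -- tree convention: `Summit.BirchSwinnertonDyer.BirchSwinnertonDyer.Theorems` (summit = sub-problem)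

noncomputable section

open scoped Classical Pointwise

namespace Summit.BirchSwinnertonDyer.BirchSwinnertonDyer.Theorems.GenusExact.FrobeniusCriterion

open WeierstrassCurve NumberField IsDedekindDomain Field WithZero
open Literature.NumberTheory.EllipticCurves Literature.NumberTheory.GaloisRepresentations
open Summit.BirchSwinnertonDyer.BirchSwinnertonDyer.Theorems.KolyvaginEigenTwo

variable (W : WeierstrassCurve ℚ) [W.IsElliptic]

/-! ## §1 The regular generator of `E[2^M]` over `ℤ/2^M[c₀]` on `Δ < 0` -/

/-- **`E[2^M] = ℤP ⊕ ℤ·c₀P` freely over `ℤ/2^M`, for every complex conjugation `c₀`, when `Δ(E) < 0`**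
(Q1 `CyclicTorsionOfNegDisc` of the route, with generation AND independence for the SAME `P`): a
`2`-torsion point `v` moved by `c₀` (`exists_twoTorsion_smul_ne_of_Δ_neg`, one real `2`-torsion point),
`P` with `2^{M−1}P = v` (`E(ℚ̄)` divisible); independence by `pow_dvd_of_zsmul_add_zsmul_smul_eq_zero`,
generation by counting `#E[2^M] = 4^M`. [cite: SilvermanAEC2009, Cor. III.6.4(b)] [cite: GrossLMS1991, §4] -/
theorem exists_regular_generator_of_Δ_neg (hΔ : W.Δ < 0) {c₀ : absoluteGaloisGroup ℚ}
    (hc₀ : IsComplexConjugation (Rat.castHom ℝ) c₀) {M : ℕ} (hM : 1 ≤ M) :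
    ∃ P : geomTorsion W ((2 ^ M : ℕ) : ℤ), (2 : ℤ) ^ M • P = 0 ∧
      (∀ Q : geomTorsion W ((2 ^ M : ℕ) : ℤ), ∃ x y : ℤ, Q = x • P + y • c₀ • P) ∧
      (∀ x y : ℤ, x • P + y • c₀ • P = 0 → (2 : ℤ) ^ M ∣ x ∧ (2 : ℤ) ^ M ∣ y) := by
  obtain ⟨v, hv⟩ := exists_twoTorsion_smul_ne_of_Δ_neg W hΔ hc₀
  have hv2 : (2 : ℤ) • (v : geomPoints W) = 0 := (mem_geomTorsion_iff W 2 (v : geomPoints W)).mp v.2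
  have hcv : c₀ • (v : geomPoints W) ≠ (v : geomPoints W) := fun h ↦ hv (Subtype.ext h)
  have hq0 : (((2 ^ (M - 1) : ℕ) : ℤ)) ≠ 0 := by positivity
  obtain ⟨P, hP⟩ := W.zsmul_geomPoints_surjective_of_charZero hq0 (v : geomPoints W)
  have hPv : ((2 ^ (M - 1) : ℕ) : ℤ) • P = (v : geomPoints W) := hP
  have h2M : ((2 ^ M : ℕ) : ℤ) = 2 * ((2 ^ (M - 1) : ℕ) : ℤ) := by
    push_cast
    rw [← pow_succ', Nat.sub_add_cancel hM]
  have hPM : P ∈ geomTorsion W ((2 ^ M : ℕ) : ℤ) := by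
    rw [mem_geomTorsion_iff, h2M, mul_smul, hPv, hv2]
  set P₀ : geomTorsion W ((2 ^ M : ℕ) : ℤ) := ⟨P, hPM⟩ with hP₀
  have hPM' : (2 : ℤ) ^ M • P = 0 := by
    have h := (mem_geomTorsion_iff W _ P).mp hPM
    push_cast at h
    exact h
  have hP₀M : (2 : ℤ) ^ M • P₀ = 0 := Subtype.ext (by
    rw [AddSubgroupClass.coe_zsmul, ZeroMemClass.coe_zero]; exact hPM')
  have hfree : ∀ a b : ℤ, a • P₀ + b • c₀ • P₀ = 0 → (2 : ℤ) ^ M ∣ a ∧ (2 : ℤ) ^ M ∣ b := by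
    intro a b hab
    have hab' : a • P + b • (c₀ • P) = 0 := congrArg Subtype.val hab
    have hPv' : (2 : ℤ) ^ (M - 1) • P = (v : geomPoints W) := by
      have h := hPv
      push_cast at h
      exact h
    exact pow_dvd_of_zsmul_add_zsmul_smul_eq_zero hv2 hcv M P hPM' hPv' a b hab'
  refine ⟨P₀, hP₀M, ?_, hfree⟩
  -- generation by counting: `(a, b) ↦ aP + b·c₀P` is injective on `(ℤ/2^M)²`, and `#E[2^M] = 4^M`
  haveI : NeZero (2 ^ M) := ⟨pow_ne_zero _ two_ne_zero⟩
  let g : ZMod (2 ^ M) × ZMod (2 ^ M) → geomTorsion W ((2 ^ M : ℕ) : ℤ) := fun ab ↦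
    (ab.1.val : ℤ) • P₀ + (ab.2.val : ℤ) • c₀ • P₀
  have hmod : ∀ {x y : ZMod (2 ^ M)}, ((2 : ℤ) ^ M) ∣ (x.val : ℤ) - y.val → x = y := by
    intro x y hxy
    apply ZMod.val_injective (2 ^ M)
    have hxy' : (((2 ^ M : ℕ) : ℕ) : ℤ) ∣ (x.val : ℤ) - y.val := by push_cast; exact hxy
    exact ((Nat.modEq_iff_dvd.mpr hxy').eq_of_lt_of_lt (ZMod.val_lt y) (ZMod.val_lt x)).symm
  have hinj : Function.Injective g := by
    rintro ⟨a, b⟩ ⟨a', b'⟩ h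
    have h' : ((a.val : ℤ) - a'.val) • P₀ + ((b.val : ℤ) - b'.val) • c₀ • P₀ = 0 := by
      simp only [g] at h
      rw [sub_zsmul, sub_zsmul, ← sub_eq_zero.mpr h]
      abel
    obtain ⟨ha, hb⟩ := hfree _ _ h'
    exact Prod.ext (hmod ha) (hmod hb)
  have hcardT : Nat.card (geomTorsion W ((2 ^ M : ℕ) : ℤ)) = (2 ^ M) ^ 2 :=
    card_torsionPoints_eq_sq_holds W (AlgebraicClosure ℚ) (n := 2 ^ M)
      (by exact_mod_cast pow_ne_zero M two_ne_zero)
  haveI : Finite (geomTorsion W ((2 ^ M : ℕ) : ℤ)) :=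
    Nat.finite_of_card_ne_zero (by rw [hcardT]; positivity)
  have hle : Nat.card (geomTorsion W ((2 ^ M : ℕ) : ℤ)) ≤ Nat.card (ZMod (2 ^ M) × ZMod (2 ^ M)) := by
    rw [hcardT, Nat.card_prod, Nat.card_zmod, sq]
  have hbij : Function.Bijective g := hinj.bijective_of_nat_card_le hle
  intro Q
  obtain ⟨⟨a, b⟩, hab⟩ := hbij.2 Q
  exact ⟨(a.val : ℤ), (b.val : ℤ), hab.symm⟩

/-! ## §2 Tame values are anti-invariant under a Frobenius inverting `μ_q` -/

section Tame

variable {v : HeightOneSpectrum (𝓞 ℚ)}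

/-- **Conjugation by an element stabilising `𝔓` preserves the inertia group `I_𝔓`.** [folklore] -/
theorem conj_mem_inertia {𝔓 : Ideal (absIntegers (𝓞 ℚ) ℚ)} {F : absoluteGaloisGroup ℚ} (hF : F • 𝔓 = 𝔓)
    {σ : absoluteGaloisGroup ℚ} (hσ : σ ∈ 𝔓.inertia (absoluteGaloisGroup ℚ)) :
    F * σ * F⁻¹ ∈ 𝔓.inertia (absoluteGaloisGroup ℚ) := by
  rw [Ideal.inertia, AddSubgroup.mem_inertia] at hσ ⊢
  intro b
  have h1 : (F * σ * F⁻¹) • b - b = F • (σ • (F⁻¹ • b) - F⁻¹ • b) := by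
    rw [smul_sub, mul_smul, mul_smul, smul_inv_smul]
  rw [h1, ← hF]
  exact Ideal.smul_mem_pointwise_smul_iff.mpr (hσ (F⁻¹ • b))

/-- **Tame values of a class are ANTI-invariant under a Frobenius inverting `μ_q`**: for `E = W/ℚ`,
`q = p^M`, a finite place `v ∤ q` with `I_𝔓` fixing `E[q]` (`𝔓 ∣ v`), `F ∈ Γ_ℚ` stabilising `𝔓` and
inverting the `q`-th roots of unity (a Frobenius at a Kolyvagin prime: Gross (3.3)), `d ∈ H¹(ℚ, E[q])`
and `σ ∈ I_𝔓`: **`F·[d, σ] = −[d, σ]`**. Proof: `F·[d, σ] = [d, FσF⁻¹]` (`h1Eval_conj`); `[d, ·]|_{I_𝔓}`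
factors through the Kummer character `θ` of `π^{1/q}` (`π` a uniformiser at `v`, tree `InertiaTame`),
and `θ(FσF⁻¹) = F(θ(σ)) = θ(σ)⁻¹ = θ(σ⁻¹)`, so `[d, FσF⁻¹] = [d, σ⁻¹] = −[d, σ]`.
[cite: GrossLMS1991, §3 (3.3) and Prop. 8.1] [cite: SerreInventiones1972, §1.3, §1.8] -/
theorem smul_h1Eval_eq_neg_of_mem_inertia {p : ℕ} (hp : p.Prime) {M : ℕ} {q : ℕ} (hq : q = p ^ M)
    (hqv : (q : 𝓞 ℚ) ∉ v.asIdeal) {𝔓 : Ideal (absIntegers (𝓞 ℚ) ℚ)} (h𝔓 : 𝔓 ∈ v.primesAbove)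
    {F : absoluteGaloisGroup ℚ} (hF𝔓 : F • 𝔓 = 𝔓)
    (hFμ : ∀ ζ : AlgebraicClosure ℚ, ζ ^ q = 1 → F • ζ = ζ⁻¹)
    (hIfix : 𝔓.inertia (absoluteGaloisGroup ℚ) ≤ torsionFixing W (q : ℤ))
    (d : galH1Torsion W (q : ℤ)) {σ : absoluteGaloisGroup ℚ}
    (hσ : σ ∈ 𝔓.inertia (absoluteGaloisGroup ℚ)) :
    F • h1Eval W (q : ℤ) d σ = -h1Eval W (q : ℤ) d σ := by
  have hq0 : q ≠ 0 := by rw [hq]; exact pow_ne_zero M hp.ne_zero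
  have hqpos : 0 < q := Nat.pos_of_ne_zero hq0
  haveI : 𝔓.IsPrime := h𝔓.1
  -- `E[q]` is finite and killed by `q`
  have hcard : Nat.card (geomTorsion W (q : ℤ)) = q ^ 2 :=
    card_torsionPoints_eq_sq_holds W (AlgebraicClosure ℚ) (n := q) (by exact_mod_cast hq0)
  haveI : Finite (geomTorsion W (q : ℤ)) := Nat.finite_of_card_ne_zero (by rw [hcard]; positivity)
  have hTq : ∀ P : geomTorsion W (q : ℤ), q • P = 0 := fun P ↦ by
    have := (mem_geomTorsion_iff W q _).mp P.2
    apply Subtype.ext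
    rw [AddSubgroupClass.coe_nsmul, ← natCast_zsmul]
    exact this
  -- the tame homomorphism `av = [d, ·]|_{I_𝔓}`
  set av : 𝔓.inertia (absoluteGaloisGroup ℚ) → geomTorsion W (q : ℤ) :=
    fun τ ↦ h1Eval W (q : ℤ) d τ with hav
  have hac : Continuous av := (continuous_h1Eval _ _ d).comp continuous_subtype_val
  have haa : ∀ τ τ', av (τ * τ') = av τ + av τ' := fun τ τ' ↦ h1Eval_mul W (q : ℤ) d (hIfix τ.2) τ'
  -- a uniformiser `π` at `v` and a `q`-th root `z` of it
  set π : ℚ := (Rat.HeightOneSpectrum.natGenerator v : ℚ) with hπdef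
  have hπ : v.valuation ℚ π = exp (-1 : ℤ) := Rat.valuation_natGenerator v
  obtain ⟨z, hz⟩ := IsAlgClosed.exists_pow_nat_eq (algebraMap ℚ (AlgebraicClosure ℚ) π) hqpos
  have hπ0 : π ≠ 0 := by
    rw [hπdef]; exact_mod_cast (Rat.HeightOneSpectrum.prime_natGenerator v).ne_zero
  have hz0 : z ≠ 0 := by
    intro h0
    rw [h0, zero_pow hq0, eq_comm, map_eq_zero] at hz
    exact hπ0 hz
  have hπfix : ∀ τ : absoluteGaloisGroup ℚ,
      τ • algebraMap ℚ (AlgebraicClosure ℚ) π = algebraMap ℚ (AlgebraicClosure ℚ) π :=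
    fun τ ↦ by rw [absoluteGaloisGroup.smul_def]; exact AlgEquiv.commutes _ π
  have hθq : ∀ τ : absoluteGaloisGroup ℚ, (τ • z / z) ^ q = 1 := fun τ ↦
    InertiaTame.smul_div_pow_eq_one hz hz0 (hπfix τ)
  have hIμ : ∀ {τ : absoluteGaloisGroup ℚ}, τ ∈ 𝔓.inertia (absoluteGaloisGroup ℚ) →
      ∀ {ζ : AlgebraicClosure ℚ}, ζ ^ q = 1 → τ • ζ = ζ := fun hτ _ hζ ↦
    InertiaTame.smul_eq_of_mem_inertia_of_pow_eq_one v hqpos hqv h𝔓 hτ hζ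
  -- `σ⁻¹ z = θ(σ)⁻¹ z`
  have hinvz : σ⁻¹ • z = (σ • z / z)⁻¹ * z := by
    have h1 := InertiaTame.mul_smul_div_eq hz0 (τ := σ⁻¹) (σ' := σ) (hIμ (inv_mem hσ) (hθq σ))
    rw [inv_mul_cancel, one_smul, div_self hz0] at h1
    have h2 : σ⁻¹ • z / z = (σ • z / z)⁻¹ := eq_inv_of_mul_eq_one_left h1.symm
    rw [← h2, div_mul_cancel₀ _ hz0]
  -- `(FσF⁻¹) z = F(θ(σ)) z = θ(σ)⁻¹ z = σ⁻¹ z`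
  set t : AlgebraicClosure ℚ ≃ₐ[ℚ] AlgebraicClosure ℚ := absoluteGaloisGroup.toAlgEquiv ℚ F with htdef
  have htF : ∀ y, t y = F • y := fun y ↦ rfl
  have htπ : t.toRingEquiv (algebraMap ℚ (AlgebraicClosure ℚ) π) = algebraMap ℚ (AlgebraicClosure ℚ) π :=
    t.commutes π
  have hcz : (F * σ * F⁻¹) • z = σ⁻¹ • z := by
    have h1 := InertiaTame.ringEquiv_apply_apply_symm_root t.toRingEquiv hz hz0 htπ (fun y ↦ σ • y)
      (fun ζ hζ y ↦ by rw [smul_mul', hIμ hσ hζ])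
    -- `h1 : t (σ • t⁻¹ z) = t (σ • z / z) * z`
    have hsymm : t.toRingEquiv.symm z = F⁻¹ • z := by
      apply t.toRingEquiv.injective
      rw [RingEquiv.apply_symm_apply]
      change z = F • F⁻¹ • z
      rw [smul_inv_smul]
    have h2 : (F * σ * F⁻¹) • z = t.toRingEquiv (σ • t.toRingEquiv.symm z) := by
      rw [hsymm, mul_smul, mul_smul]
      rfl
    rw [h2, h1, hinvz]
    exact congrArg (· * z) (hFμ _ (hθq σ))
  -- conclude
  have hconj : F * σ * F⁻¹ ∈ 𝔓.inertia (absoluteGaloisGroup ℚ) := conj_mem_inertia hF𝔓 hσ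
  have h1 : F • h1Eval W (q : ℤ) d σ = av ⟨F * σ * F⁻¹, hconj⟩ := by
    rw [hav]
    exact (h1Eval_conj W (q : ℤ) d F (hIfix hσ)).symm
  have h2 : av ⟨F * σ * F⁻¹, hconj⟩ = av ⟨σ⁻¹, inv_mem hσ⟩ :=
    InertiaTame.apply_eq_apply_of_smul_root_eq v hqpos hqv hπ hz h𝔓 hTq av hac haa hcz
  rw [h1, h2, hav]
  exact h1Eval_inv W (q : ℤ) d (hIfix hσ)

end Tame

/-! ## §3 McCallum's Lemma 5.3 with Prop. 2.2 over `ℚ_ℓ` at `2` -/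

section Main

variable {v : HeightOneSpectrum (𝓞 ℚ)}

/-- `2 ∉ v` at the place `v` of an odd prime `ℓ` (`gcd(2, ℓ) = 1`). [folklore] -/
theorem two_notMem_of_odd_prime_mem {ℓ : ℕ} (hℓ : ℓ.Prime) (hℓ2 : ℓ ≠ 2)
    (hℓv : (ℓ : 𝓞 ℚ) ∈ v.asIdeal) : ((2 : ℕ) : 𝓞 ℚ) ∉ v.asIdeal := by
  intro h2
  have hcop : Nat.Coprime 2 ℓ := (Nat.coprime_primes Nat.prime_two hℓ).mpr (Ne.symm hℓ2)
  obtain ⟨a, b, hab⟩ := Nat.isCoprime_iff_coprime.mpr hcop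
  have h1 : (1 : 𝓞 ℚ) ∈ v.asIdeal := by
    have hcast : ((a * ((2 : ℕ) : ℤ) + b * ((ℓ : ℕ) : ℤ) : ℤ) : 𝓞 ℚ) = 1 := by rw [hab]; norm_num
    have heq : ((a * ((2 : ℕ) : ℤ) + b * ((ℓ : ℕ) : ℤ) : ℤ) : 𝓞 ℚ) =
        (a : 𝓞 ℚ) * ((2 : ℕ) : 𝓞 ℚ) + (b : 𝓞 ℚ) * (ℓ : 𝓞 ℚ) := by
      push_cast; ring
    rw [← hcast, heq]
    exact v.asIdeal.add_mem (v.asIdeal.mul_mem_left _ h2) (v.asIdeal.mul_mem_left _ hℓv)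
  exact v.isPrime.ne_top ((Ideal.eq_top_iff_one _).mpr h1)

/-- **McCallum 1991, Lemma 5.3 with Prop. 2.2, over `ℚ_ℓ` at `p = 2`, from Kolyvagin reciprocity over
`ℚ`** (the `ℚ`-level twin of the tree's `lemma_5_3_descent_of_reciprocity`, which needs `p` odd). Let
`E = W/ℚ` be elliptic with `Δ < 0`, `q = 2^M` (`M ≥ 1`), `ℓ` an odd prime at the place `v` of good
reduction, and `Frob(ℓ) = Frob(∞)` on `ℚ(E[q])` (`FrobEqFrobInfty W K q ℓ`, a Gross–Kolyvagin prime of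
depth `M`; `K` is only carried by the predicate). Let `e` be a biadditive ALTERNATING left-non-degenerate
pairing on `E[q]` (the Weil pairing `e_q` through Kolyvagin's (7.6)). Let `d ∈ H¹(ℚ, E[q])` with
`2^a d` NOT Selmer at `v`, and `s ∈ H¹(ℚ, E[q])` Selmer at `v`. ASSUME the reciprocity value vanishes
at the prime `𝔓 ∣ ℓ` of the chosen embedding: `e([s, F], [d, σ]) = 0` for every arithmetic Frobenius `F`
at every `𝔓 ∣ v` acting on `E[q]` as a complex conjugation and every `σ ∈ I_𝔓` (McCallum's Prop. 2.2,
*"the sum of the local invariants of a global class is zero"*, made explicit at `ℓ`). **Then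
`2^{M−1−a}·s_v = 0` in `H¹(ℚ_ℓ, E[q])`** — the printed exponent, NO defect at `2`: over `ℚ_ℓ`,
`E(ℚ_ℓ)/q` and `H¹(ℚ_ℓ, E)_q` are cyclic of order `q` (the coinvariant and conorm lines of the regular
`ℤ/q[F]`-module `E[q]`). Proof: §1 (regular generator, `F` a regular involution), §2 (tame values in
`E[q]^{F = −1}`, cyclic, one of order `> 2^a` by Gross (7.1)), and
`…FrobeniusCriterion.pow_zsmul_mem_torsionLocalKer_of_pairing_eq_zero`.
[cite: McCallumLMS1991, §5 Lemma 5.3 (with §2 Prop. 2.2)] [cite: GrossLMS1991, §3 (3.2)–(3.3), (7.1), Prop. 9.6] -/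
theorem lemma_5_3_descent_of_reciprocity_rat_two (hΔ : W.Δ < 0) {M : ℕ} (hM : 1 ≤ M) {q : ℕ}
    (hq : q = 2 ^ M) {ℓ : ℕ} (hℓ : ℓ.Prime) (hℓ2 : ℓ ≠ 2) (hℓv : (ℓ : 𝓞 ℚ) ∈ v.asIdeal)
    (hgood : W.HasGoodReductionAt v) {K : Type} [Field K] [NumberField K]
    (hℓM : FrobEqFrobInfty W K q ℓ)
    {C : Type*} [AddCommGroup C] (e : geomTorsion W (q : ℤ) →+ geomTorsion W (q : ℤ) →+ C)
    (halt : ∀ x, e x x = 0) (hnd : ∀ x, (∀ y, e x y = 0) → x = 0)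
    {d : galH1Torsion W (q : ℤ)} {a : ℕ}
    (hdv : ((2 : ℤ) ^ a) • d ∉ selmerLocalKer W (v.adicCompletion ℚ) (q : ℤ))
    {s : galH1Torsion W (q : ℤ)} (hs : s ∈ selmerLocalKer W (v.adicCompletion ℚ) (q : ℤ))
    (hR : ∀ 𝔓 ∈ v.primesAbove, ∀ F c₀ : absoluteGaloisGroup ℚ, IsArithFrobAt (𝓞 ℚ) F 𝔓 →
      IsComplexConjugation (Rat.castHom ℝ) c₀ → (∀ P : geomTorsion W (q : ℤ), F • P = c₀ • P) →
      ∀ σ ∈ 𝔓.inertia (absoluteGaloisGroup ℚ),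
        e (h1Eval W (q : ℤ) s F) (h1Eval W (q : ℤ) d σ) = 0) :
    ((2 : ℤ) ^ (M - 1 - a)) • s ∈ W.torsionLocalKer (v.adicCompletion ℚ) (q : ℤ) := by
  subst hq
  -- ### Step 0: `2, q ∉ v`, `v` good
  have h2v : ((2 : ℕ) : 𝓞 ℚ) ∉ v.asIdeal := two_notMem_of_odd_prime_mem hℓ hℓ2 hℓv
  have hqv' : ((2 ^ M : ℕ) : 𝓞 ℚ) ∉ v.asIdeal := by
    rw [Nat.cast_pow]
    exact fun h ↦ h2v (v.isPrime.mem_of_pow_mem M h)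
  have hqv : ((((2 ^ M : ℕ) : ℤ)) : 𝓞 ℚ) ∉ v.asIdeal := by rwa [Int.cast_natCast]
  have hq0 : (2 ^ M : ℕ) ≠ 0 := pow_ne_zero M two_ne_zero
  have hq0Z : ((2 ^ M : ℕ) : ℤ) ≠ 0 := by exact_mod_cast hq0
  have hwbad : v ∉ W.badPlaces (𝓞 ℚ) := fun h ↦ h hgood
  -- ### Step 1: the prime `𝔓` of the chosen embedding, a Frobenius `F` there acting as `c₀`
  obtain ⟨𝔐, h𝔐⟩ := v.localPrimesAbove_nonempty
  set 𝔓 := v.primeBelow (closureEmb (K := ℚ) (v.adicCompletion ℚ)) 𝔐 with h𝔓def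
  have h𝔓 : 𝔓 ∈ v.primesAbove := HeightOneSpectrum.primeBelow_mem_primesAbove h𝔐
  haveI : 𝔓.IsPrime := h𝔓.1
  obtain ⟨F, c₀, hFrob, hc₀, hE, -⟩ := FrobEqFrobInfty.exists_at (W := W) (K := K) hℓ hℓM hℓv h𝔓
  -- ### Step 2: `E[q]` is a regular `ℤ/q[F]`-module
  obtain ⟨P, hPM, hgen, hfree⟩ := exists_regular_generator_of_Δ_neg W hΔ hc₀ hM
  have hgenF : ∀ Q : geomTorsion W ((2 ^ M : ℕ) : ℤ), ∃ x y : ℤ, Q = x • P + y • F • P := by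
    intro Q; rw [hE P]; exact hgen Q
  have hfreeF : ∀ x y : ℤ, x • P + y • F • P = 0 → (2 : ℤ) ^ M ∣ x ∧ (2 : ℤ) ^ M ∣ y := by
    intro x y h; rw [hE P] at h; exact hfree x y h
  have hF : ∀ Q : geomTorsion W ((2 ^ M : ℕ) : ℤ), F • F • Q = Q := fun Q ↦ by
    rw [hE, hE, ← mul_smul, ← pow_two, hc₀.sq_eq_one, one_smul]
  -- ### Step 3: the inputs of the local criterion
  have hI : 𝔓.inertia (absoluteGaloisGroup ℚ) ≤ torsionFixing W ((2 ^ M : ℕ) : ℤ) :=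
    inertia_le_torsionFixing W hwbad hqv _ h𝔐
  have hopen := isOpen_torsionFixing W hq0Z
  haveI : CharZero (v.adicCompletion ℚ) :=
    charZero_of_injective_algebraMap (algebraMap ℚ (v.adicCompletion ℚ)).injective
  -- the `ℚ`-algebra structure on `ℚ_v` is the canonical `instAlgebraAdicCompletion` (fed by unification;
  -- the tree's two `Algebra ℚ ℚ_v` instances are not definitionally equal)
  have hsurj : Function.Surjective (@torsionPointsMap ℚ _ W (v.adicCompletion ℚ) _
      (HeightOneSpectrum.instAlgebraAdicCompletion (𝓞 ℚ) ℚ v) ((2 ^ M : ℕ) : ℤ)) :=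
    (@torsionPointsMap_bijective ℚ _ _ W _ (v.adicCompletion ℚ) _
      (HeightOneSpectrum.instAlgebraAdicCompletion (𝓞 ℚ) ℚ v) _ (2 ^ M) hq0).2
  have hx : s ∈ unramifiedKer (geomTorsion W ((2 ^ M : ℕ) : ℤ)) 𝔓 :=
    selmerLocalKer_le_unramifiedKer (HeightOneSpectrum.exists_mem_inertia_apply_eq_holds v)
      W.smul_localPoints_eq_of_mem_inertia_holds hwbad hqv h𝔓 hs
  -- ### Step 4: the tame side — a tame value of `d` of order `> 2^a`, anti-invariant under `F`
  have hd0 : ∃ σ₀ ∈ 𝔓.inertia (absoluteGaloisGroup ℚ),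
      ((2 : ℤ) ^ a) • h1Eval W ((2 ^ M : ℕ) : ℤ) d σ₀ ≠ 0 := by
    by_contra hall
    push Not at hall
    apply hdv
    rw [← oneCocycleClass_reprCocycle W ((2 ^ M : ℕ) : ℤ) (((2 : ℤ) ^ a) • d)]
    refine (W.oneCocycleClass_mem_selmerLocalKer_iff hgood hqv h𝔓
      (reprCocycle W ((2 ^ M : ℕ) : ℤ) (((2 : ℤ) ^ a) • d))).mpr fun τ hτ ↦ ?_
    have h1 := hall τ hτ
    change h1Eval W ((2 ^ M : ℕ) : ℤ) (((2 : ℤ) ^ a) • d) τ = 0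
    rwa [h1Eval_zsmul _ _ _ _ (hI hτ)]
  -- cyclicity of the tame image: a generator `σ₁`
  have hcard : Nat.card (geomTorsion W ((2 ^ M : ℕ) : ℤ)) = (2 ^ M) ^ 2 :=
    card_torsionPoints_eq_sq_holds W (AlgebraicClosure ℚ) (n := 2 ^ M) (by exact_mod_cast hq0)
  haveI : Finite (geomTorsion W ((2 ^ M : ℕ) : ℤ)) :=
    Nat.finite_of_card_ne_zero (by rw [hcard]; positivity)
  have hTq : ∀ Q : geomTorsion W ((2 ^ M : ℕ) : ℤ), (2 ^ M) • Q = 0 := fun Q ↦ by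
    have := (mem_geomTorsion_iff W ((2 ^ M : ℕ) : ℤ) _).mp Q.2
    apply Subtype.ext
    rw [AddSubgroupClass.coe_nsmul, ← natCast_zsmul]
    exact_mod_cast this
  set av : 𝔓.inertia (absoluteGaloisGroup ℚ) → geomTorsion W ((2 ^ M : ℕ) : ℤ) :=
    fun τ ↦ h1Eval W ((2 ^ M : ℕ) : ℤ) d τ with hav
  have hac : Continuous av := (continuous_h1Eval _ _ d).comp continuous_subtype_val
  have haa : ∀ τ τ', av (τ * τ') = av τ + av τ' := fun τ τ' ↦
    h1Eval_mul W ((2 ^ M : ℕ) : ℤ) d (hI τ.2) τ'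
  have hπ : v.valuation ℚ (Rat.HeightOneSpectrum.natGenerator v : ℚ) = exp (-1 : ℤ) :=
    Rat.valuation_natGenerator v
  obtain ⟨z, hz⟩ := IsAlgClosed.exists_pow_nat_eq
    (algebraMap ℚ (AlgebraicClosure ℚ) (Rat.HeightOneSpectrum.natGenerator v : ℚ)) (Nat.pos_of_ne_zero hq0)
  obtain ⟨σ₁, -, hgenσ⟩ :=
    InertiaTame.exists_forall_apply_eq_nsmul v (Nat.pos_of_ne_zero hq0) hqv' hπ hz h𝔓 hTq av hac haa
  have hy₀a : ((2 : ℤ) ^ a) • av σ₁ ≠ 0 := by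
    obtain ⟨σ₀, hσ₀, hσ₀a⟩ := hd0
    intro h0
    apply hσ₀a
    obtain ⟨k, hk⟩ := hgenσ ⟨σ₀, hσ₀⟩
    change ((2 : ℤ) ^ a) • av ⟨σ₀, hσ₀⟩ = 0
    rw [hk, smul_comm, h0, smul_zero]
  -- `F` inverts `μ_q` (Gross (3.3)) and stabilises `𝔓`, so `F·[d, σ₁] = −[d, σ₁]`
  have hFμ : ∀ ζ : AlgebraicClosure ℚ, ζ ^ (2 ^ M) = 1 → F • ζ = ζ⁻¹ := fun ζ hζ ↦
    smul_eq_inv_of_smul_torsion_pow_eq W Nat.prime_two hM rfl hc₀ hE hζ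
  have hF𝔓 : F • 𝔓 = 𝔓 := MulAction.mem_stabilizer_iff.mp hFrob.mem_stabilizer
  have ht : F • av σ₁ = -av σ₁ :=
    smul_h1Eval_eq_neg_of_mem_inertia W Nat.prime_two rfl hqv' h𝔓 hF𝔓 hFμ hI d σ₁.2
  -- ### Step 5: the reciprocity value and the no-defect Lemma 5.3 over `ℚ_ℓ`
  have het : e (h1Eval W ((2 ^ M : ℕ) : ℤ) s F) (av σ₁) = 0 := hR 𝔓 h𝔓 F c₀ hFrob hc₀ hE σ₁ σ₁.2
  exact pow_zsmul_mem_torsionLocalKer_of_pairing_eq_zero W h𝔐 hFrob hI hopen hsurj hF hM hPM hgenF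
    hfreeF e halt hnd hx ht hy₀a het

end Main

end Summit.BirchSwinnertonDyer.BirchSwinnertonDyer.Theorems.GenusExact.FrobeniusCriterion

end
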